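import Summits.CriticalPhenomena.PercolationContinuityZ3.Theorems.PercNearOneGluingNoHeavyLowerTailFourCopyHubRelax
import HarnessLib

/-!
# `NoHeavyLowerTail` (stmt-CriticalPhenomena-4575) — the FINITE RELAXATION of three-copy switching certificates, IIc:
# 16-bit join-matrix coding of terminal types and the relaxation's transfer rules as bit operations

Support file (prover prim-cert-2 gen 12; `--supports stmt-CriticalPhenomena-4575`).  No named facts, no sorries.

Why.  The kernel checker of part II (`Cert.check`) evaluates `refines`, `rootOK`, `admClean`, `admMessy` as `decide` over
`Fin 4 × Fin 4`; each call costs thousands of kernel reduction steps, and the kernel caches every step, so certificates of the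
size of prim-l12-p1's `E1`/`E1inc` exhaust the kernel's memory (measured: "(kernel) excessive memory consumption", independent
of `maxHeartbeats`).  Here a type `t : Ty` is coded by its JOIN MATRIX `J t < 2^16` (bit `4 i + j` = `jn t i j`), the explored
mask of a root set by `wmask πX U < 16`, and the four rules become a handful of GMP-accelerated bit operations
(`refinesN`, `rootOKN`, `admCleanN`, `admMessyN`).  The BRIDGE theorems `refinesN_of_refines`, `rootOKN_of_rootOK`,
`admCleanN_of_admClean`, `admMessyN_of_admMessy` transfer part I's semantic facts to the coded rules; part IId
(`…SwitchRelaxCheckN`) builds the fast checker on them.  (Imports `…FourCopyHubRelax` only for `FourCopyHub.jn_comm`.)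
-/

namespace Summit.CriticalPhenomena.PercolationContinuityZ3.Theorems

namespace SwitchRelax

open FourPointAtoms

/-! ### Bit sets -/

/-- `a ⊆ b` as finite sets of bit positions. [folklore] -/
def bsub (a b : ℕ) : Bool := Nat.beq (a &&& b) a

/-- Meaning of `bsub`. [folklore] -/
theorem bsub_iff {a b : ℕ} : bsub a b = true ↔ ∀ n, a.testBit n = true → b.testBit n = true := by
  rw [bsub, Nat.beq_eq]
  constructor
  · intro h n ha
    have := congrArg (fun x => x.testBit n) h
    simp only [Nat.testBit_and, ha, Bool.true_and] at this
    exact this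
  · intro h
    refine Nat.eq_of_testBit_eq fun n => ?_
    rw [Nat.testBit_and]
    cases ha : a.testBit n
    · rfl
    · simpa using h n ha

/-- Four Booleans as a 4-bit number. [folklore] -/
def bitsToNat (b0 b1 b2 b3 : Bool) : ℕ :=
  (if b0 then 1 else 0) + (if b1 then 2 else 0) + (if b2 then 4 else 0) + (if b3 then 8 else 0)

/-- `bitsToNat` is below `16`. [folklore] -/
theorem bitsToNat_lt (b0 b1 b2 b3 : Bool) : bitsToNat b0 b1 b2 b3 < 16 := by
  revert b0 b1 b2 b3; decide

/-- The bits of `bitsToNat`. [folklore] -/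
theorem testBit_bitsToNat (b0 b1 b2 b3 : Bool) (n : ℕ) :
    (bitsToNat b0 b1 b2 b3).testBit n = (decide (n < 4) && [b0, b1, b2, b3].getD n false) := by
  by_cases hn : n < 4
  · obtain ⟨k, rfl⟩ : ∃ k : Fin 4, n = k.val := ⟨⟨n, hn⟩, rfl⟩
    revert b0 b1 b2 b3 k; decide
  · have hlt : bitsToNat b0 b1 b2 b3 < 2 ^ n :=
      lt_of_lt_of_le (bitsToNat_lt b0 b1 b2 b3) (le_trans (by norm_num) (Nat.pow_le_pow_right (by norm_num) (not_lt.1 hn)))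
    rw [Nat.testBit_lt_two_pow hlt]; simp [hn]

/-! ### Join matrices -/

/-- **The join matrix** of a type: bit `4 i + j` is set iff terminals `i, j` lie in one block. [this work] -/
def J (t : Ty) : ℕ :=
  (((List.finRange 4).flatMap fun i => (List.finRange 4).map fun j => if jn t i j then 2 ^ (4 * i.val + j.val) else 0)).sum

/-- Join matrices are 16-bit numbers (kernel computation). [this work] -/
theorem J_lt : ∀ t : Ty, J t < 2 ^ 16 := by decide

/-- Row index of a bit position. [folklore] -/
def fi (n : ℕ) : Fin 4 := ⟨n / 4 % 4, Nat.mod_lt _ (by norm_num)⟩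
/-- Column index of a bit position. [folklore] -/
def fj (n : ℕ) : Fin 4 := ⟨n % 4, Nat.mod_lt _ (by norm_num)⟩

/-- The bits of a join matrix below `16` (kernel computation). [this work] -/
theorem testBit_J_fin : ∀ (t : Ty) (k : Fin 16), (J t).testBit k.val = jn t (fi k.val) (fj k.val) := by decide

/-- Bits at positions `≥ 16` of a number `< 2^16` vanish. [folklore] -/
theorem testBit_eq_false_of_lt16 {x n : ℕ} (hx : x < 2 ^ 16) (hn : ¬ n < 16) : x.testBit n = false :=
  Nat.testBit_lt_two_pow (lt_of_lt_of_le hx (Nat.pow_le_pow_right (by norm_num) (not_lt.1 hn)))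

/-- **The bits of a join matrix.** [this work] -/
theorem testBit_J (t : Ty) (n : ℕ) : (J t).testBit n = (decide (n < 16) && jn t (fi n) (fj n)) := by
  by_cases hn : n < 16
  · obtain ⟨k, rfl⟩ : ∃ k : Fin 16, n = k.val := ⟨⟨n, hn⟩, rfl⟩
    rw [testBit_J_fin]; simp [k.isLt]
  · rw [testBit_eq_false_of_lt16 (J_lt t) hn]; simp [hn]

/-- Every pair of terminal indices is `(fi n, fj n)` for `n = 4 i + j < 16`. [folklore] -/
theorem fi_fj_bit (i j : Fin 4) : fi (4 * i.val + j.val) = i ∧ fj (4 * i.val + j.val) = j ∧ 4 * i.val + j.val < 16 := by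
  refine ⟨Fin.ext ?_, Fin.ext ?_, by omega⟩
  · simp only [fi]; omega
  · simp only [fj]; omega

/-! ### Row / column spreads of 4-bit sets and column extraction -/

/-- Row spread: bit `4 i + j` is bit `i` of `w`. [folklore] -/
def rowSpread (w : ℕ) : ℕ :=
  (if w.testBit 0 then 15 else 0) + (if w.testBit 1 then 240 else 0) + (if w.testBit 2 then 3840 else 0) +
    (if w.testBit 3 then 61440 else 0)

/-- Column spread: bit `4 i + j` is bit `j` of `w` (for `w < 16`). [folklore] -/
def colSpread (w : ℕ) : ℕ := (w &&& 15) * 4369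

/-- Column `v` of a 16-bit matrix as a 4-bit set: bit `i` is bit `4 i + v`. [folklore] -/
def colBits (m v : ℕ) : ℕ := bitsToNat (m.testBit v) (m.testBit (4 + v)) (m.testBit (8 + v)) (m.testBit (12 + v))

/-- All 16 bits. [folklore] -/
def full16 : ℕ := 2 ^ 16 - 1

/-- The bits of a row spread (kernel computation on `Fin 16 × Fin 16`). [folklore] -/
theorem testBit_rowSpread_fin : ∀ w k : Fin 16, (rowSpread w.val).testBit k.val = w.val.testBit (k.val / 4) := by decide
/-- The bits of a column spread (kernel computation on `Fin 16 × Fin 16`). [folklore] -/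
theorem testBit_colSpread_fin : ∀ w k : Fin 16, (colSpread w.val).testBit k.val = w.val.testBit (k.val % 4) := by decide
/-- Row spreads of 4-bit sets are 16-bit numbers. [folklore] -/
theorem rowSpread_lt : ∀ w : Fin 16, rowSpread w.val < 2 ^ 16 := by decide
/-- Column spreads of 4-bit sets are 16-bit numbers. [folklore] -/
theorem colSpread_lt : ∀ w : Fin 16, colSpread w.val < 2 ^ 16 := by decide

/-- **The bits of a row spread.** [folklore] -/
theorem testBit_rowSpread {w : ℕ} (hw : w < 16) (n : ℕ) :
    (rowSpread w).testBit n = (decide (n < 16) && w.testBit (n / 4)) := by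
  obtain ⟨w, rfl⟩ : ∃ w' : Fin 16, w = w'.val := ⟨⟨w, hw⟩, rfl⟩
  by_cases hn : n < 16
  · obtain ⟨k, rfl⟩ : ∃ k : Fin 16, n = k.val := ⟨⟨n, hn⟩, rfl⟩
    rw [testBit_rowSpread_fin]; simp [k.isLt]
  · rw [testBit_eq_false_of_lt16 (rowSpread_lt w) hn]; simp [hn]

/-- **The bits of a column spread.** [folklore] -/
theorem testBit_colSpread {w : ℕ} (hw : w < 16) (n : ℕ) :
    (colSpread w).testBit n = (decide (n < 16) && w.testBit (n % 4)) := by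
  obtain ⟨w, rfl⟩ : ∃ w' : Fin 16, w = w'.val := ⟨⟨w, hw⟩, rfl⟩
  by_cases hn : n < 16
  · obtain ⟨k, rfl⟩ : ∃ k : Fin 16, n = k.val := ⟨⟨n, hn⟩, rfl⟩
    rw [testBit_colSpread_fin]; simp [k.isLt]
  · rw [testBit_eq_false_of_lt16 (colSpread_lt w) hn]; simp [hn]

/-- `colBits` is below `16`. [folklore] -/
theorem colBits_lt (m v : ℕ) : colBits m v < 16 := bitsToNat_lt _ _ _ _

/-- **The bits of a column extraction** at row indices `< 4`. [folklore] -/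
theorem testBit_colBits (m v : ℕ) (i : Fin 4) : (colBits m v).testBit i.val = m.testBit (4 * i.val + v) := by
  rw [colBits, testBit_bitsToNat]
  fin_cases i <;> simp

/-- The bits of `full16`. [folklore] -/
theorem testBit_full16 (n : ℕ) : full16.testBit n = decide (n < 16) := Nat.testBit_two_pow_sub_one 16 n

/-- For `n < 16`: `n / 4 = fi n` as values. [folklore] -/
theorem fi_val {n : ℕ} (hn : n < 16) : (fi n).val = n / 4 := by simp [fi]; omega
/-- Companion of `fi_val`. [folklore] -/
theorem fj_val (n : ℕ) : (fj n).val = n % 4 := rfl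

/-! ### The explored mask -/

/-- **The explored mask** of root set `U` under input type `πX`: bit `i` = `inW πX U i`. [this work] -/
def wmask (πX : Ty) (U : Finset (Fin 4)) : ℕ := bitsToNat (inW πX U 0) (inW πX U 1) (inW πX U 2) (inW πX U 3)

/-- `wmask < 16`. [this work] -/
theorem wmask_lt (πX : Ty) (U : Finset (Fin 4)) : wmask πX U < 16 := bitsToNat_lt _ _ _ _

/-- **The bits of the explored mask.** [this work] -/
theorem testBit_wmask (πX : Ty) (U : Finset (Fin 4)) (i : Fin 4) : (wmask πX U).testBit i.val = inW πX U i := by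
  rw [wmask, testBit_bitsToNat]
  fin_cases i <;> simp

/-! ### The coded rules -/

/-- Coded refinement: `J p ⊆ J t`. [this work] -/
def refinesN (jp jt : ℕ) : Bool := bsub jp jt

/-- Coded root-block rule: rows of the mask inside `J p` lie inside `J πX`. [this work] -/
def rootOKN (jX w jp : ℕ) : Bool := bsub (rowSpread w &&& jp) jX

/-- Coded CLEAN output rule: `J q = (rows(W) ∩ J πX) ∪ (outside W × outside W ∩ J p)`. [this work] -/
def admCleanN (jX w jp jq : ℕ) : Bool :=
  Nat.beq jq ((rowSpread w &&& jX) ||| ((full16 ^^^ (rowSpread w ||| colSpread w)) &&& jp))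

/-- Coded MESSY output rule (M1: the `πX`-block of `v` is a block; M2: `J p ⊆ J q`; M3: joins of `q` absent from `p` meet `v`). [this work] -/
def admMessyN (jX w v jt jp jq : ℕ) : Bool :=
  (w.testBit v && Nat.beq jq jt) ||
  (!w.testBit v &&
    (bsub (rowSpread (colBits jX v) &&& colSpread (colBits jX v)) jq && bsub jp jq &&
      bsub (jq ^^^ (jq &&& jp)) (rowSpread (colBits jq v))))

/-! ### Bridges from the `Ty`-level rules of parts I/II -/

/-- A bit of a join matrix that is set lies below `16` and names a joined pair. [this work] -/
theorem jn_of_testBit_J {t : Ty} {n : ℕ} (h : (J t).testBit n = true) : n < 16 ∧ jn t (fi n) (fj n) = true := by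
  rw [testBit_J] at h; simpa using h

/-- **Bridge for refinement.** [this work] -/
theorem refinesN_of_refines {p t : Ty} (h : refines p t = true) : refinesN (J p) (J t) = true := by
  rw [refines, decide_eq_true_iff] at h
  rw [refinesN, bsub_iff]
  intro n hn
  obtain ⟨hn16, hj⟩ := jn_of_testBit_J hn
  rw [testBit_J]; simpa [hn16] using h _ _ hj

/-- **Bridge for the root-block rule.** [this work] -/
theorem rootOKN_of_rootOK {πX p : Ty} {U : Finset (Fin 4)} (h : rootOK πX U p = true) :
    rootOKN (J πX) (wmask πX U) (J p) = true := by
  rw [rootOK, decide_eq_true_iff] at h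
  rw [rootOKN, bsub_iff]
  intro n hn
  rw [Nat.testBit_and, Bool.and_eq_true, testBit_rowSpread (wmask_lt πX U)] at hn
  obtain ⟨hn16, hj⟩ := jn_of_testBit_J hn.2
  have hw : (wmask πX U).testBit (fi n).val = true := by rw [fi_val hn16]; simpa [hn16] using hn.1
  rw [testBit_wmask] at hw
  rw [testBit_J]; simpa [hn16] using h _ _ hw hj

/-- **Bridge for the clean output rule.** [this work] -/
theorem admCleanN_of_admClean {πX p q : Ty} {U : Finset (Fin 4)} (h : admClean πX (inW πX U) p q = true) :
    admCleanN (J πX) (wmask πX U) (J p) (J q) = true := by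
  rw [admClean, decide_eq_true_iff] at h
  rw [admCleanN, Nat.beq_eq]
  refine Nat.eq_of_testBit_eq fun n => ?_
  have hw := wmask_lt πX U
  simp only [Nat.testBit_or, Nat.testBit_and, Nat.testBit_xor, testBit_full16, testBit_rowSpread hw, testBit_colSpread hw,
    testBit_J]
  by_cases hn : n < 16
  · have hi : (wmask πX U).testBit (n / 4) = inW πX U (fi n) := by rw [← fi_val hn, testBit_wmask]
    have hj' : (wmask πX U).testBit (n % 4) = inW πX U (fj n) := by rw [← fj_val n, testBit_wmask]
    rw [hi, hj', h (fi n) (fj n)]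
    simp only [hn, decide_true, Bool.true_and, Bool.true_xor]
    cases inW πX U (fi n) <;> cases inW πX U (fj n) <;> simp
  · simp [hn]

/-- **Bridge for the messy output rule.** [this work] -/
theorem admMessyN_of_admMessy {πX t p q : Ty} {U : Finset (Fin 4)} {v : Fin 4}
    (h : admMessy πX (inW πX U) v t p q = true) :
    admMessyN (J πX) (wmask πX U) v.val (J t) (J p) (J q) = true := by
  rw [admMessy] at h
  rw [admMessyN, testBit_wmask]
  cases hv : inW πX U v
  · -- `τ v ∉ W`: M1, M2, M3
    rw [hv] at h
    simp only [Bool.false_and, Bool.not_false, Bool.true_and, Bool.false_or, decide_eq_true_iff] at h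
    obtain ⟨h1, h2, h3⟩ := h
    simp only [Bool.false_and, Bool.not_false, Bool.true_and, Bool.false_or, Bool.and_eq_true]
    refine ⟨⟨?_, ?_⟩, ?_⟩
    · -- M1
      rw [bsub_iff]; intro n hn
      rw [Nat.testBit_and, Bool.and_eq_true, testBit_rowSpread (colBits_lt _ _), testBit_colSpread (colBits_lt _ _)] at hn
      have hn16 : n < 16 := by
        have := hn.1; simp only [Bool.and_eq_true, decide_eq_true_iff] at this; exact this.1
      have hi : (colBits (J πX) v.val).testBit (n / 4) = jn πX v (fi n) := by
        rw [← fi_val hn16, testBit_colBits, testBit_J, FourCopyHub.jn_comm]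
        simp [(fi_fj_bit (fi n) v).2.2, (fi_fj_bit (fi n) v).1, (fi_fj_bit (fi n) v).2.1]
      have hj : (colBits (J πX) v.val).testBit (n % 4) = jn πX v (fj n) := by
        rw [← fj_val n, testBit_colBits, testBit_J, FourCopyHub.jn_comm]
        simp [(fi_fj_bit (fj n) v).2.2, (fi_fj_bit (fj n) v).1, (fi_fj_bit (fj n) v).2.1]
      rw [hi] at hn; rw [hj] at hn
      have h1' := h1 (fi n) (fj n) (by simpa [hn16] using hn.1) (by simpa [hn16] using hn.2)
      rw [testBit_J]; simp [hn16, h1']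
    · -- M2
      rw [bsub_iff]; intro n hn
      obtain ⟨hn16, hj⟩ := jn_of_testBit_J hn
      rw [testBit_J]; simpa [hn16] using h2 _ _ hj
    · -- M3
      rw [bsub_iff]; intro n hn
      rw [Nat.testBit_xor, Nat.testBit_and] at hn
      have hq : (J q).testBit n = true := by
        cases hq : (J q).testBit n
        · rw [hq] at hn; simp at hn
        · rfl
      have hp : (J p).testBit n = false := by
        cases hp : (J p).testBit n
        · rfl
        · rw [hq, hp] at hn; simp at hn
      obtain ⟨hn16, hjq⟩ := jn_of_testBit_J hq
      have hjp : jn p (fi n) (fj n) = false := by rw [testBit_J] at hp; simpa [hn16] using hp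
      have h3' := h3 (fi n) (fj n) hjq hjp
      rw [testBit_rowSpread (colBits_lt _ _)]
      simp only [hn16, decide_true, Bool.true_and]
      rw [← fi_val hn16, testBit_colBits, testBit_J]
      simp [(fi_fj_bit (fi n) v).2.2, (fi_fj_bit (fi n) v).1, (fi_fj_bit (fi n) v).2.1, h3']
  · -- `τ v ∈ W`: the output is `T`
    rw [hv] at h
    simp only [Bool.true_and, Bool.not_true, Bool.false_and, Bool.or_false, decide_eq_true_iff] at h
    subst h
    simp

end SwitchRelax

end Summit.CriticalPhenomena.PercolationContinuityZ3.Theorems
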